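import Mathlib
import Literature.MathematicalPhysics.QuantumLattice.PerronFrobeniusGroundState
import HarnessLib

/-!
# The lattice fixed-node (effective) Hamiltonian

For a finite index type `n` ("configurations"), a complex matrix `A : Matrix n n ℂ` (a lattice
Hamiltonian written in a configuration basis; intended: real symmetric entries, e.g. the Hubbard
torus Hamiltonian `hubbardTorus 2 L t U` in the occupation-number basis `Finset (Orb Λ)`) and a
real *guiding (trial) vector* `f : n → ℝ` (the `ψ_T` of the Monte Carlo literature), an ordered
pair `(i, k)` with `k ≠ i` is a **sign-flip ("bad") pair** when `Re (A i k) · f i · f k > 0`.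
The **lattice fixed-node Hamiltonian** `fixedNodeMatrix A f` ("`H_eff`", "`FN(A, f)`") deletes the
bad off-diagonal entries of `A` and adds the **sign-flip potential**
`V_sf(i) = Σ_{k bad} Re (A i k) · f k / f i` to the diagonal:

* `F i j = A i j` on good pairs, `F i j = 0` on bad pairs, `F i i = A i i + V_sf(i)`

(Gubernatis–Kawashima–Werner 2016, §11.2, eqs. (11.2)–(11.4); the construction is due to
van Bemmel–ten Haaf–van Saarloos–van Leeuwen–An, PRL 72 (1994) 2442 and ten Haaf–van Bemmel–
van Leeuwen–van Saarloos–Ceperley, PRB 51 (1995) 13039; textbook account also in Becca–Sorella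
2017, §10.4, eqs. (10.34)–(10.38), where the local energy `e_L` is first subtracted and then added
back, so it cancels). The **fixed-node correction** `fixedNodeCorrection A f := F − A` is the
operator `𝒪^fn` of Becca–Sorella (10.42) (diagonal `V_sf(i)`, `−A i j` on bad pairs, `0` elsewhere),
and the **node-release family** `nodeRelease A f γ := A + γ • (F − A)` runs from `A` (`γ = 0`)
through `F` (`γ = 1`); `γ = 1 + γ'` is Becca–Sorella's `ℋ^{fn,γ'} = ℋ + (1 + γ') 𝒪^fn` (10.41).

## Main statements (all proved)

* `fixedNodeMatrix_eq_add_fixedNodeCorrection`, `fixedNodeCorrection_eq_of` — `F = A + (F − A)`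
  and the entrywise formula of the correction (the form inlined by route statements).
* `fixedNodeMatrix_symm`, `star_fixedNodeMatrix_apply`, `fixedNodeMatrix_isHermitian` (and the
  same for the correction) — real symmetric in, real symmetric out.
* `fixedNodeMatrix_re_apply_mul_mul_nonpos` — `Re (F i j) · f i · f j ≤ 0` for `i ≠ j`: `F` is
  stoquastic (sign-problem free) in the signed basis `sgn (f i) • |i⟩` (GKW (11.2); Becca–Sorella,
  text after (10.37)). Needs no hypothesis at all.
* `fixedNodeCorrection_mulVec_ofReal`, `fixedNodeMatrix_mulVec_ofReal` — `(F − A) f = 0`, i.e.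
  `F f = A f` ("`H |ψ_T⟩ = H_eff |ψ_T⟩`", GKW p. 383; Becca–Sorella (10.39)), for `A` with real
  entries.
* `fixedNodeCorrection_re_quadForm_nonneg`, `fixedNodeCorrection_posSemidef`,
  `re_quadForm_le_fixedNodeMatrix` — `0 ≤ Re ⟨v, (F − A) v⟩` for every complex vector `v`, hence
  `Re ⟨v, A v⟩ ≤ Re ⟨v, F v⟩`, for `A` with real symmetric entries: the mechanism of the lattice
  fixed-node **upper bound** `E_eff ≥ E₀` (GKW (11.8); ten Haaf et al. 1995; Becca–Sorella
  (10.43)–(10.45)), by the symmetrisation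
  `Re ⟨v, (F − A) v⟩ = ½ Σ_{bad (i,k)} Re A_{ik} f_i f_k |v_i / f_i − v_k / f_k|² ≥ 0`.
* `nodeRelease_zero`, `nodeRelease_one`, `nodeRelease_mulVec_ofReal`,
  `re_quadForm_nodeRelease_mono` — the node-release family is pinned on `f` and monotone in `γ` as
  a quadratic form (Becca–Sorella (10.41), (10.47)).

## Design notes

* The helper `signFlipKernel A f i k` (`= Re (A i k)` on bad pairs, `0` otherwise; real, vanishing
  on the diagonal, symmetric for symmetric `A`) and `signFlipPotential A f i = V_sf(i)` carry the
  proofs: for real-entry `A`, `(F − A) i j = δ_ij V_sf(i) − signFlipKernel A f i j`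
  (`fixedNodeCorrection_apply`) and `((F − A) v) i = Σ_k signFlipKernel A f i k · ((f k / f i) v i − v k)`
  (`fixedNodeCorrection_mulVec_apply`).
* Deliberately NOT here (route items for provers, who can now cite this file): the
  Perron–Frobenius consequences on a connected good graph (apply
  `perronFrobenius_groundState_pos` to `diag (sgn f) * F * diag (sgn f)`), and the variational
  window / concavity of `γ ↦ (nodeRelease A f γ).minEnergyOn K`.

## References

* J. Gubernatis, N. Kawashima, P. Werner, *Quantum Monte Carlo Methods: Algorithms for Lattice
  Models*, CUP 2016, §11.2 (eqs. (11.2)–(11.4)) and §11.4 (eq. (11.8), p. 383).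
  [GubernatisKawashimaWerner2016]
* F. Becca, S. Sorella, *Quantum Monte Carlo Approaches for Correlated Systems*, CUP 2017, §10.4,
  eqs. (10.34)–(10.47). [BeccaSorella2017]
* D. F. B. ten Haaf, H. J. M. van Bemmel, J. M. J. van Leeuwen, W. van Saarloos, D. M. Ceperley,
  *Proof for an upper bound in fixed-node Monte Carlo for lattice fermions*, Phys. Rev. B 51 (1995)
  13039. [TenhaafEtAl1995]
* H. J. M. van Bemmel, D. F. B. ten Haaf, W. van Saarloos, J. M. J. van Leeuwen, G. An, *Fixed-node
  quantum Monte Carlo method for lattice fermions*, Phys. Rev. Lett. 72 (1994) 2442.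
  [VanbemmelEtAl1994]
-/

noncomputable section

namespace Literature.MathematicalPhysics.QuantumLattice

open Matrix Finset
open scoped ComplexOrder

variable {n : Type*} [Fintype n] [DecidableEq n]

/-! ### Definitions -/

/-- **The lattice fixed-node (effective) Hamiltonian** `FN(A, f)` of a complex matrix `A` with
respect to a real guiding vector `f`: with *bad (sign-flip) pairs* `k ≠ i`,
`Re (A i k) * f i * f k > 0`, the off-diagonal entry is `0` on bad pairs and `A i j` otherwise, and
the diagonal entry is `A i i + V_sf(i)`, `V_sf(i) = Σ_{k bad} Re (A i k) * f k / f i` (the sign-flip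
potential). Gubernatis–Kawashima–Werner (2016) §11.2, eqs. (11.2)–(11.4); ten Haaf et al.,
PRB 51 (1995) 13039; van Bemmel et al., PRL 72 (1994) 2442. The body is *literally* the expression
inlined by the route statements that requested the definition, so `F = fixedNodeMatrix A f`
unfolds to them by `rfl`. No hypothesis on `f` is needed: a row `i` with `f i = 0` carries no bad
pair, so Lean's junk value `x / 0 = 0` is never used. Intended for `A` with real (symmetric)
entries; only real parts of entries enter the bad-pair test and `V_sf`.
[cite: GubernatisKawashimaWerner2016, §11.2 eqs. (11.2)–(11.4)] -/
def fixedNodeMatrix (A : Matrix n n ℂ) (f : n → ℝ) : Matrix n n ℂ :=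
  Matrix.of fun i j => if i = j then A i i + ∑ k, (if k ≠ i ∧ 0 < (A i k).re * f i * f k then
    ((((A i k).re * f k / f i : ℝ)) : ℂ) else 0) else (if 0 < (A i j).re * f i * f j then 0 else A i j)

/-- **The fixed-node correction** `FN(A, f) − A`: diagonal entries the sign-flip potential
`V_sf(i)`, off-diagonal entries `−A i j` on bad pairs and `0` elsewhere
(`fixedNodeCorrection_eq_of`); for `A` with real symmetric entries a positive semidefinite matrix
annihilating `f` (`fixedNodeCorrection_posSemidef`, `fixedNodeCorrection_mulVec_ofReal`). This is
the operator `𝒪^fn` of Becca–Sorella (2017) §10.4, eq. (10.42) (`= V_sf − H_sf` in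
Gubernatis–Kawashima–Werner (2016) §11.4). [cite: BeccaSorella2017, §10.4 eq. (10.42)] -/
def fixedNodeCorrection (A : Matrix n n ℂ) (f : n → ℝ) : Matrix n n ℂ :=
  fixedNodeMatrix A f - A

/-- **The node-release family** `A + γ • (FN(A, f) − A)`, `γ : ℝ`: `γ = 0` is `A`, `γ = 1` is the
fixed-node Hamiltonian (`nodeRelease_zero`, `nodeRelease_one`); for `γ ≥ 1` it is Becca–Sorella's
`ℋ^{fn, γ−1} = ℋ + γ 𝒪^fn` (2017, §10.4, eq. (10.41)), whose ground energy is non-decreasing in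
`γ` ((10.47)) and which Sorella's released-node scheme extrapolates towards `γ = 0`.
[cite: BeccaSorella2017, §10.4 eq. (10.41)] -/
def nodeRelease (A : Matrix n n ℂ) (f : n → ℝ) (γ : ℝ) : Matrix n n ℂ :=
  A + (γ : ℂ) • fixedNodeCorrection A f

/-- The **sign-flip kernel**: `Re (A i k)` on bad pairs (`k ≠ i`, `Re (A i k) * f i * f k > 0`),
`0` otherwise. Auxiliary real kernel through which `V_sf` and the correction are expressed
(Becca–Sorella's `s_{x,x'} > 0` restriction, (10.36)–(10.37)). [cite: BeccaSorella2017, §10.4 eq. (10.36)] -/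
def signFlipKernel (A : Matrix n n ℂ) (f : n → ℝ) (i k : n) : ℝ :=
  if k ≠ i ∧ 0 < (A i k).re * f i * f k then (A i k).re else 0

/-- The **sign-flip potential** `V_sf(i) = Σ_{k bad} Re (A i k) * f k / f i`.
Gubernatis–Kawashima–Werner (2016) eq. (11.4); Becca–Sorella (2017) eq. (10.37).
[cite: GubernatisKawashimaWerner2016, §11.2 eq. (11.4)] -/
def signFlipPotential (A : Matrix n n ℂ) (f : n → ℝ) (i : n) : ℝ :=
  ∑ k, signFlipKernel A f i k * f k / f i

/-! ### Unfolding lemmas -/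

/-- The definition of `fixedNodeMatrix` as an equation (the inline form used by route
statements). [folklore] -/
theorem fixedNodeMatrix_eq_of (A : Matrix n n ℂ) (f : n → ℝ) :
    fixedNodeMatrix A f = Matrix.of (fun i j => if i = j then A i i + ∑ k,
      (if k ≠ i ∧ 0 < (A i k).re * f i * f k then ((((A i k).re * f k / f i : ℝ)) : ℂ) else 0)
      else (if 0 < (A i j).re * f i * f j then 0 else A i j)) :=
  rfl

/-- Diagonal entries of the fixed-node matrix: `A i i` plus the sign-flip sum. [folklore] -/
theorem fixedNodeMatrix_apply_self (A : Matrix n n ℂ) (f : n → ℝ) (i : n) :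
    fixedNodeMatrix A f i i = A i i + ∑ k,
      (if k ≠ i ∧ 0 < (A i k).re * f i * f k then ((((A i k).re * f k / f i : ℝ)) : ℂ) else 0) := by
  simp [fixedNodeMatrix]

/-- Off-diagonal entries of the fixed-node matrix: bad hops deleted, good hops kept. [folklore] -/
theorem fixedNodeMatrix_apply_of_ne (A : Matrix n n ℂ) (f : n → ℝ) {i j : n} (hij : i ≠ j) :
    fixedNodeMatrix A f i j = if 0 < (A i j).re * f i * f j then 0 else A i j := by
  simp [fixedNodeMatrix, hij]

/-- A bad (sign-flip) hop is deleted. [folklore] -/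
theorem fixedNodeMatrix_apply_of_bad (A : Matrix n n ℂ) (f : n → ℝ) {i j : n} (hij : i ≠ j)
    (hbad : 0 < (A i j).re * f i * f j) : fixedNodeMatrix A f i j = 0 := by
  rw [fixedNodeMatrix_apply_of_ne A f hij, if_pos hbad]

/-- A good hop is kept. [folklore] -/
theorem fixedNodeMatrix_apply_of_good (A : Matrix n n ℂ) (f : n → ℝ) {i j : n} (hij : i ≠ j)
    (hgood : (A i j).re * f i * f j ≤ 0) : fixedNodeMatrix A f i j = A i j := by
  rw [fixedNodeMatrix_apply_of_ne A f hij, if_neg (not_lt.mpr hgood)]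

omit [Fintype n] in
/-- The sign-flip kernel vanishes on the diagonal. [folklore] -/
@[simp] theorem signFlipKernel_self (A : Matrix n n ℂ) (f : n → ℝ) (i : n) :
    signFlipKernel A f i i = 0 := by
  simp [signFlipKernel]

omit [Fintype n] in
/-- A nonzero value of the sign-flip kernel is `Re (A i k)` on a bad pair. [folklore] -/
theorem signFlipKernel_spec {A : Matrix n n ℂ} {f : n → ℝ} {i k : n}
    (h : signFlipKernel A f i k ≠ 0) :
    signFlipKernel A f i k = (A i k).re ∧ k ≠ i ∧ 0 < (A i k).re * f i * f k := by
  unfold signFlipKernel at h ⊢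
  by_cases hP : k ≠ i ∧ 0 < (A i k).re * f i * f k
  · exact ⟨if_pos hP, hP⟩
  · exact absurd (if_neg hP) h

omit [Fintype n] in
/-- Rows of nodal configurations (`f i = 0`) carry no sign flips. [folklore] -/
theorem signFlipKernel_of_eq_zero (A : Matrix n n ℂ) {f : n → ℝ} {i : n} (hi : f i = 0) (k : n) :
    signFlipKernel A f i k = 0 := by
  simp [signFlipKernel, hi]

omit [Fintype n] in
/-- The sign-flip kernel of a symmetric matrix is symmetric. [folklore] -/
theorem signFlipKernel_symm {A : Matrix n n ℂ} (hsymm : ∀ i j, A i j = A j i) (f : n → ℝ)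
    (i k : n) : signFlipKernel A f i k = signFlipKernel A f k i := by
  unfold signFlipKernel
  rw [hsymm k i, mul_right_comm ((A i k).re) (f k) (f i)]
  by_cases h : k ≠ i ∧ 0 < (A i k).re * f i * f k
  · rw [if_pos h, if_pos ⟨Ne.symm h.1, h.2⟩]
  · rw [if_neg h, if_neg (fun h' => h ⟨Ne.symm h'.1, h'.2⟩)]

/-- The diagonal of the fixed-node matrix is `A i i + V_sf(i)`.
[cite: GubernatisKawashimaWerner2016, §11.2 eq. (11.3)] -/
theorem fixedNodeMatrix_apply_self_eq_signFlipPotential (A : Matrix n n ℂ) (f : n → ℝ) (i : n) :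
    fixedNodeMatrix A f i i = A i i + (signFlipPotential A f i : ℂ) := by
  rw [fixedNodeMatrix_apply_self, signFlipPotential, Complex.ofReal_sum]
  congr 1
  refine Finset.sum_congr rfl fun k _ => ?_
  unfold signFlipKernel
  split_ifs <;> simp

/-- For `A` with real entries, the off-diagonal entries of the fixed-node matrix are
`A i j − signFlipKernel A f i j`. [folklore] -/
theorem fixedNodeMatrix_apply_of_ne_eq_sub {A : Matrix n n ℂ} (hreal : ∀ i j, star (A i j) = A i j)
    (f : n → ℝ) {i j : n} (hij : i ≠ j) :
    fixedNodeMatrix A f i j = A i j - (signFlipKernel A f i j : ℂ) := by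
  rw [fixedNodeMatrix_apply_of_ne A f hij]
  unfold signFlipKernel
  by_cases h : 0 < (A i j).re * f i * f j
  · rw [if_pos h, if_pos ⟨Ne.symm hij, h⟩]
    have : A i j = ((A i j).re : ℂ) := (Complex.conj_eq_iff_re.1 (hreal i j)).symm
    rw [← this, sub_self]
  · rw [if_neg h, if_neg (fun h' => h h'.2)]
    simp

/-! ### The correction `F − A` -/

/-- `F = A + (F − A)`. [folklore] -/
theorem fixedNodeMatrix_eq_add_fixedNodeCorrection (A : Matrix n n ℂ) (f : n → ℝ) :
    fixedNodeMatrix A f = A + fixedNodeCorrection A f := by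
  rw [fixedNodeCorrection, add_sub_cancel]

/-- Entrywise form of the fixed-node correction: diagonal = the sign-flip sum, off-diagonal
= `−A i j` on bad pairs and `0` elsewhere (the form inlined by route statements).
[cite: BeccaSorella2017, §10.4 eq. (10.42)] -/
theorem fixedNodeCorrection_eq_of (A : Matrix n n ℂ) (f : n → ℝ) :
    fixedNodeCorrection A f = Matrix.of (fun i j => if i = j then ∑ k,
      (if k ≠ i ∧ 0 < (A i k).re * f i * f k then ((((A i k).re * f k / f i : ℝ)) : ℂ) else 0)
      else (if 0 < (A i j).re * f i * f j then -A i j else 0)) := by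
  ext i j
  simp only [fixedNodeCorrection, Matrix.sub_apply, of_apply]
  by_cases hij : i = j
  · subst hij
    rw [fixedNodeMatrix_apply_self, if_pos rfl, add_sub_cancel_left]
  · rw [fixedNodeMatrix_apply_of_ne A f hij, if_neg hij]
    split_ifs <;> simp

/-- For `A` with real entries, `(F − A) i j = δ_ij V_sf(i) − signFlipKernel A f i j` (the kernel
vanishes on the diagonal). [cite: BeccaSorella2017, §10.4 eq. (10.42)] -/
theorem fixedNodeCorrection_apply {A : Matrix n n ℂ} (hreal : ∀ i j, star (A i j) = A i j)
    (f : n → ℝ) (i j : n) :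
    fixedNodeCorrection A f i j =
      (((if i = j then signFlipPotential A f i else 0) - signFlipKernel A f i j : ℝ) : ℂ) := by
  simp only [fixedNodeCorrection, Matrix.sub_apply]
  by_cases hij : i = j
  · subst hij
    rw [fixedNodeMatrix_apply_self_eq_signFlipPotential, if_pos rfl, signFlipKernel_self]
    push_cast
    ring
  · rw [fixedNodeMatrix_apply_of_ne_eq_sub hreal f hij, if_neg hij]
    push_cast
    ring

/-- For `A` with real entries, `((F − A) v) i = Σ_k signFlipKernel A f i k · ((f k / f i) v i − v k)`.
[cite: BeccaSorella2017, §10.4 eq. (10.43)] -/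
theorem fixedNodeCorrection_mulVec_apply {A : Matrix n n ℂ} (hreal : ∀ i j, star (A i j) = A i j)
    (f : n → ℝ) (v : n → ℂ) (i : n) :
    (fixedNodeCorrection A f *ᵥ v) i =
      ∑ k, (signFlipKernel A f i k : ℂ) * (((f k / f i : ℝ) : ℂ) * v i - v k) := by
  simp only [mulVec, dotProduct, fixedNodeCorrection_apply hreal]
  have h1 : ∀ j, ((((if i = j then signFlipPotential A f i else 0) - signFlipKernel A f i j : ℝ)) : ℂ)
      * v j = (if i = j then (signFlipPotential A f i : ℂ) * v j else 0)
        - (signFlipKernel A f i j : ℂ) * v j := by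
    intro j
    split_ifs <;> push_cast <;> ring
  simp only [h1, Finset.sum_sub_distrib, Finset.sum_ite_eq, Finset.mem_univ, if_true]
  rw [signFlipPotential, Complex.ofReal_sum, Finset.sum_mul, ← Finset.sum_sub_distrib]
  refine Finset.sum_congr rfl fun k _ => ?_
  push_cast
  ring

/-- **The fixed-node correction annihilates the guiding vector**: `(F − A) f = 0`, for `A` with
real entries ("`H |ψ_T⟩ = H_eff |ψ_T⟩`", Gubernatis–Kawashima–Werner (2016) p. 383;
Becca–Sorella (2017) eq. (10.39)). [cite: BeccaSorella2017, §10.4 eq. (10.39)] -/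
theorem fixedNodeCorrection_mulVec_ofReal {A : Matrix n n ℂ} (hreal : ∀ i j, star (A i j) = A i j)
    (f : n → ℝ) : fixedNodeCorrection A f *ᵥ (fun i => ((f i : ℝ) : ℂ)) = 0 := by
  ext i
  rw [fixedNodeCorrection_mulVec_apply hreal, Pi.zero_apply]
  refine Finset.sum_eq_zero fun k _ => ?_
  by_cases hfi : f i = 0
  · rw [signFlipKernel_of_eq_zero A hfi, Complex.ofReal_zero, zero_mul]
  · have : ((f k / f i : ℝ) : ℂ) * (f i : ℂ) - (f k : ℂ) = 0 := by
      rw [← Complex.ofReal_mul, div_mul_cancel₀ _ hfi, sub_self]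
    rw [this, mul_zero]

/-- `F f = A f` for `A` with real entries (Gubernatis–Kawashima–Werner (2016) p. 383;
Becca–Sorella (2017) eq. (10.39)). [cite: GubernatisKawashimaWerner2016, §11.4 p. 383] -/
theorem fixedNodeMatrix_mulVec_ofReal {A : Matrix n n ℂ} (hreal : ∀ i j, star (A i j) = A i j)
    (f : n → ℝ) :
    fixedNodeMatrix A f *ᵥ (fun i => ((f i : ℝ) : ℂ)) = A *ᵥ (fun i => ((f i : ℝ) : ℂ)) := by
  rw [fixedNodeMatrix_eq_add_fixedNodeCorrection, add_mulVec, fixedNodeCorrection_mulVec_ofReal hreal,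
    add_zero]

/-! ### Symmetry and reality -/

/-- The fixed-node matrix of a symmetric matrix is symmetric. [folklore] -/
theorem fixedNodeMatrix_symm {A : Matrix n n ℂ} (hsymm : ∀ i j, A i j = A j i) (f : n → ℝ)
    (i j : n) : fixedNodeMatrix A f i j = fixedNodeMatrix A f j i := by
  by_cases hij : i = j
  · subst hij
    rfl
  · rw [fixedNodeMatrix_apply_of_ne A f hij, fixedNodeMatrix_apply_of_ne A f (Ne.symm hij), hsymm j i,
      mul_right_comm ((A i j).re) (f j) (f i)]

/-- The fixed-node matrix of a matrix with real entries has real entries. [folklore] -/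
theorem star_fixedNodeMatrix_apply {A : Matrix n n ℂ} (hreal : ∀ i j, star (A i j) = A i j)
    (f : n → ℝ) (i j : n) : star (fixedNodeMatrix A f i j) = fixedNodeMatrix A f i j := by
  by_cases hij : i = j
  · subst hij
    rw [fixedNodeMatrix_apply_self_eq_signFlipPotential, star_add, hreal]
    simp
  · rw [fixedNodeMatrix_apply_of_ne A f hij]
    split_ifs
    · exact star_zero _
    · exact hreal i j

/-- The fixed-node matrix of a matrix with real symmetric entries is Hermitian. [folklore] -/
theorem fixedNodeMatrix_isHermitian {A : Matrix n n ℂ} (hsymm : ∀ i j, A i j = A j i)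
    (hreal : ∀ i j, star (A i j) = A i j) (f : n → ℝ) : (fixedNodeMatrix A f).IsHermitian :=
  Matrix.IsHermitian.ext fun i j => by
    rw [fixedNodeMatrix_symm hsymm f j i, star_fixedNodeMatrix_apply hreal]

/-- The fixed-node correction of a symmetric matrix is symmetric. [folklore] -/
theorem fixedNodeCorrection_symm {A : Matrix n n ℂ} (hsymm : ∀ i j, A i j = A j i) (f : n → ℝ)
    (i j : n) : fixedNodeCorrection A f i j = fixedNodeCorrection A f j i := by
  rw [fixedNodeCorrection, Matrix.sub_apply, Matrix.sub_apply, fixedNodeMatrix_symm hsymm f i j, hsymm i j]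

/-- The fixed-node correction of a matrix with real entries has real entries. [folklore] -/
theorem star_fixedNodeCorrection_apply {A : Matrix n n ℂ} (hreal : ∀ i j, star (A i j) = A i j)
    (f : n → ℝ) (i j : n) : star (fixedNodeCorrection A f i j) = fixedNodeCorrection A f i j := by
  rw [fixedNodeCorrection, Matrix.sub_apply, star_sub, star_fixedNodeMatrix_apply hreal, hreal]

/-- The fixed-node correction of a matrix with real symmetric entries is Hermitian. [folklore] -/
theorem fixedNodeCorrection_isHermitian {A : Matrix n n ℂ} (hsymm : ∀ i j, A i j = A j i)
    (hreal : ∀ i j, star (A i j) = A i j) (f : n → ℝ) : (fixedNodeCorrection A f).IsHermitian :=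
  Matrix.IsHermitian.ext fun i j => by
    rw [fixedNodeCorrection_symm hsymm f j i, star_fixedNodeCorrection_apply hreal]

/-! ### Stoquasticity in the signed basis -/

/-- **The fixed-node matrix is sign-problem free in the signed basis `sgn (f i) • |i⟩`**:
`Re (F i j) · f i · f j ≤ 0` for `i ≠ j` (bad hops are deleted, good hops have this sign by
definition). No hypothesis on `A` or `f`. Gubernatis–Kawashima–Werner (2016) (11.2);
Becca–Sorella (2017), discussion after (10.37). [cite: GubernatisKawashimaWerner2016, §11.2 eq. (11.2)] -/
theorem fixedNodeMatrix_re_apply_mul_mul_nonpos (A : Matrix n n ℂ) (f : n → ℝ) {i j : n}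
    (hij : i ≠ j) : (fixedNodeMatrix A f i j).re * f i * f j ≤ 0 := by
  rw [fixedNodeMatrix_apply_of_ne A f hij]
  split_ifs with h
  · simp
  · exact not_lt.mp h

/-- Good hops of `A` (`i ≠ j`, `Re (A i j) · f i · f j < 0`) are nonzero entries of the fixed-node
matrix: the good graph of `A` is contained in the graph of `F`. [folklore] -/
theorem fixedNodeMatrix_apply_ne_zero_of_good (A : Matrix n n ℂ) (f : n → ℝ) {i j : n}
    (hij : i ≠ j) (hgood : (A i j).re * f i * f j < 0) : fixedNodeMatrix A f i j ≠ 0 := by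
  rw [fixedNodeMatrix_apply_of_good A f hij hgood.le]
  intro h
  rw [h, Complex.zero_re, zero_mul, zero_mul] at hgood
  exact lt_irrefl 0 hgood

/-! ### Positivity of the correction (the fixed-node upper bound) -/

/-- The algebra of one symmetrised sign-flip pair:
`a (q/p |x|² + p/q |y|² − 2 Re (x̄ y)) = a p q |x/p − y/q|² ≥ 0` when `a p q > 0`. [folklore] -/
private theorem pair_nonneg {a p q : ℝ} (h : 0 < a * p * q) (x y : ℂ) :
    0 ≤ a * (q / p * Complex.normSq x - (x.re * y.re + x.im * y.im)) +
        a * (p / q * Complex.normSq y - (y.re * x.re + y.im * x.im)) := by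
  have hp : p ≠ 0 := by
    rintro rfl
    simp at h
  have hq : q ≠ 0 := by
    rintro rfl
    simp at h
  have key : a * (q / p * Complex.normSq x - (x.re * y.re + x.im * y.im)) +
      a * (p / q * Complex.normSq y - (y.re * x.re + y.im * x.im)) =
      a * p * q * ((x.re / p - y.re / q) ^ 2 + (x.im / p - y.im / q) ^ 2) := by
    rw [Complex.normSq_apply, Complex.normSq_apply]
    field_simp
    ring
  rw [key]
  exact mul_nonneg h.le (add_nonneg (sq_nonneg _) (sq_nonneg _))

/-- Real part of the quadratic form of the correction as a double sum over sign-flip pairs,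
`Re ⟨v, (F − A) v⟩ = Σ_i Σ_k signFlipKernel A f i k · ((f k / f i) |v i|² − Re (v̄ i · v k))`, for
`A` with real entries and any complex `v` (Becca–Sorella (2017) eq. (10.43)).
[cite: BeccaSorella2017, §10.4 eq. (10.43)] -/
theorem re_quadForm_fixedNodeCorrection {A : Matrix n n ℂ} (hreal : ∀ i j, star (A i j) = A i j)
    (f : n → ℝ) (v : n → ℂ) :
    (star v ⬝ᵥ fixedNodeCorrection A f *ᵥ v).re = ∑ i, ∑ k, signFlipKernel A f i k *
      (f k / f i * Complex.normSq (v i) - ((v i).re * (v k).re + (v i).im * (v k).im)) := by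
  simp only [dotProduct, fixedNodeCorrection_mulVec_apply hreal, Pi.star_apply, Finset.mul_sum,
    Complex.re_sum]
  refine Finset.sum_congr rfl fun i _ => Finset.sum_congr rfl fun k _ => ?_
  simp only [Complex.mul_re, Complex.sub_re, Complex.sub_im, Complex.mul_im, Complex.ofReal_re,
    Complex.ofReal_im, Complex.star_def, Complex.conj_re, Complex.conj_im, Complex.normSq_apply]
  ring

/-- **The fixed-node correction is positive**: `0 ≤ Re ⟨v, (F − A) v⟩` for every complex vector
`v`, for `A` with real symmetric entries. By the symmetry of the sign-flip kernel,
`2 Re ⟨v, (F − A) v⟩ = Σ_{i,k} signFlipKernel A f i k · f i f k · |v i / f i − v k / f k|² ≥ 0`.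
This is the mechanism of the lattice fixed-node upper bound `E_eff ≥ E₀`:
Gubernatis–Kawashima–Werner (2016) eq. (11.8); ten Haaf et al., PRB 51 (1995) 13039;
Becca–Sorella (2017) eqs. (10.43)–(10.44). [cite: GubernatisKawashimaWerner2016, §11.4 eq. (11.8)] -/
theorem fixedNodeCorrection_re_quadForm_nonneg {A : Matrix n n ℂ} (hsymm : ∀ i j, A i j = A j i)
    (hreal : ∀ i j, star (A i j) = A i j) (f : n → ℝ) (v : n → ℂ) :
    0 ≤ (star v ⬝ᵥ fixedNodeCorrection A f *ᵥ v).re := by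
  rw [re_quadForm_fixedNodeCorrection hreal]
  set G : n → n → ℝ := fun i k => signFlipKernel A f i k *
      (f k / f i * Complex.normSq (v i) - ((v i).re * (v k).re + (v i).im * (v k).im)) with hG
  show 0 ≤ ∑ i, ∑ k, G i k
  have hswap : ∑ i, ∑ k, G i k = ∑ i, ∑ k, G k i := Finset.sum_comm
  have hpair : ∀ i k, 0 ≤ G i k + G k i := by
    intro i k
    simp only [hG]
    rw [signFlipKernel_symm hsymm f k i]
    by_cases hb : signFlipKernel A f i k = 0
    · rw [hb]
      simp
    · obtain ⟨hval, -, hpos⟩ := signFlipKernel_spec hb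
      rw [hval]
      exact pair_nonneg hpos (v i) (v k)
  have h2 : ∑ i, ∑ k, (G i k + G k i) = 2 * ∑ i, ∑ k, G i k := by
    simp only [Finset.sum_add_distrib]
    rw [← hswap, two_mul]
  have hnn : 0 ≤ ∑ i, ∑ k, (G i k + G k i) :=
    Finset.sum_nonneg fun i _ => Finset.sum_nonneg fun k _ => hpair i k
  linarith

omit [DecidableEq n] in
/-- The quadratic form of a Hermitian matrix is self-adjoint. [folklore] -/
private theorem star_quadForm_of_isHermitian {M : Matrix n n ℂ} (hM : M.IsHermitian)
    (v : n → ℂ) : star (star v ⬝ᵥ M *ᵥ v) = star v ⬝ᵥ M *ᵥ v :=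
  calc star (star v ⬝ᵥ M *ᵥ v) = star (M *ᵥ v) ⬝ᵥ v := by rw [star_dotProduct, star_star]
    _ = star v ⬝ᵥ Mᴴ *ᵥ v := by rw [star_mulVec, ← dotProduct_mulVec]
    _ = star v ⬝ᵥ M *ᵥ v := by rw [hM.eq]

/-- **The fixed-node correction is positive semidefinite** (Mathlib's `Matrix.PosSemidef`), for `A`
with real symmetric entries: `F − A = Σ_{bad {i,k}} Re A_{ik} f_i f_k · u u^⊤ ⪰ 0`,
`u = e_i / f_i − e_k / f_k`. Becca–Sorella (2017) eq. (10.44); ten Haaf et al. (1995).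
[cite: BeccaSorella2017, §10.4 eq. (10.44)] -/
theorem fixedNodeCorrection_posSemidef {A : Matrix n n ℂ} (hsymm : ∀ i j, A i j = A j i)
    (hreal : ∀ i j, star (A i j) = A i j) (f : n → ℝ) : (fixedNodeCorrection A f).PosSemidef := by
  refine Matrix.PosSemidef.of_dotProduct_mulVec_nonneg
    (fixedNodeCorrection_isHermitian hsymm hreal f) fun v => ?_
  have him : (star v ⬝ᵥ fixedNodeCorrection A f *ᵥ v).im = 0 :=
    Complex.conj_eq_iff_im.1
      (star_quadForm_of_isHermitian (fixedNodeCorrection_isHermitian hsymm hreal f) v)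
  exact Complex.nonneg_iff.2 ⟨fixedNodeCorrection_re_quadForm_nonneg hsymm hreal f v, him.symm⟩

/-- `Re ⟨v, F v⟩ = Re ⟨v, A v⟩ + Re ⟨v, (F − A) v⟩`. [folklore] -/
theorem re_quadForm_fixedNodeMatrix (A : Matrix n n ℂ) (f : n → ℝ) (v : n → ℂ) :
    (star v ⬝ᵥ fixedNodeMatrix A f *ᵥ v).re =
      (star v ⬝ᵥ A *ᵥ v).re + (star v ⬝ᵥ fixedNodeCorrection A f *ᵥ v).re := by
  rw [fixedNodeMatrix_eq_add_fixedNodeCorrection, add_mulVec, dotProduct_add, Complex.add_re]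

/-- **Domination `A ⪯ FN(A, f)`**: `Re ⟨v, A v⟩ ≤ Re ⟨v, F v⟩` for every `v`, for `A` with real
symmetric entries — whence `E₀(A) ≤ E₀(F)`, the lattice fixed-node upper bound
(Gubernatis–Kawashima–Werner (2016) p. 383, `E_eff ≥ E₀`; ten Haaf et al. (1995); Becca–Sorella
(2017) (10.45)). [cite: GubernatisKawashimaWerner2016, §11.4 p. 383] -/
theorem re_quadForm_le_fixedNodeMatrix {A : Matrix n n ℂ} (hsymm : ∀ i j, A i j = A j i)
    (hreal : ∀ i j, star (A i j) = A i j) (f : n → ℝ) (v : n → ℂ) :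
    (star v ⬝ᵥ A *ᵥ v).re ≤ (star v ⬝ᵥ fixedNodeMatrix A f *ᵥ v).re := by
  rw [re_quadForm_fixedNodeMatrix]
  exact le_add_of_nonneg_right (fixedNodeCorrection_re_quadForm_nonneg hsymm hreal f v)

/-! ### The node-release family -/

/-- `F − A` is the fixed-node correction (definitional; the form `H + γ • (F − H)` used by route
statements is `nodeRelease`). [folklore] -/
theorem fixedNodeMatrix_sub (A : Matrix n n ℂ) (f : n → ℝ) :
    fixedNodeMatrix A f - A = fixedNodeCorrection A f :=
  rfl

/-- At `γ = 0` the node-release family is `A` itself. [folklore] -/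
@[simp] theorem nodeRelease_zero (A : Matrix n n ℂ) (f : n → ℝ) : nodeRelease A f 0 = A := by
  simp [nodeRelease]

/-- At `γ = 1` the node-release family is the fixed-node Hamiltonian. [folklore] -/
@[simp] theorem nodeRelease_one (A : Matrix n n ℂ) (f : n → ℝ) :
    nodeRelease A f 1 = fixedNodeMatrix A f := by
  simp [nodeRelease, fixedNodeCorrection]

/-- The whole node-release family agrees with `A` on the guiding vector: `(A + γ (F − A)) f = A f`
(Becca–Sorella (2017) eq. (10.39)). [cite: BeccaSorella2017, §10.4 eq. (10.39)] -/
theorem nodeRelease_mulVec_ofReal {A : Matrix n n ℂ} (hreal : ∀ i j, star (A i j) = A i j)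
    (f : n → ℝ) (γ : ℝ) :
    nodeRelease A f γ *ᵥ (fun i => ((f i : ℝ) : ℂ)) = A *ᵥ (fun i => ((f i : ℝ) : ℂ)) := by
  rw [nodeRelease, add_mulVec, Matrix.smul_mulVec, fixedNodeCorrection_mulVec_ofReal hreal,
    smul_zero, add_zero]

/-- `Re ⟨v, (A + γ (F − A)) v⟩ = Re ⟨v, A v⟩ + γ · Re ⟨v, (F − A) v⟩`. [folklore] -/
theorem re_quadForm_nodeRelease (A : Matrix n n ℂ) (f : n → ℝ) (γ : ℝ) (v : n → ℂ) :
    (star v ⬝ᵥ nodeRelease A f γ *ᵥ v).re =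
      (star v ⬝ᵥ A *ᵥ v).re + γ * (star v ⬝ᵥ fixedNodeCorrection A f *ᵥ v).re := by
  rw [nodeRelease, add_mulVec, dotProduct_add, Matrix.smul_mulVec, dotProduct_smul,
    Complex.add_re, smul_eq_mul, Complex.re_ofReal_mul]

/-- **Monotonicity of the node-release family** as quadratic forms: for `γ₁ ≤ γ₂`,
`Re ⟨v, (A + γ₁ (F − A)) v⟩ ≤ Re ⟨v, (A + γ₂ (F − A)) v⟩` (so the sector ground energies are
non-decreasing in `γ`; Becca–Sorella (2017) eq. (10.47) is the `γ`-derivative form).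
[cite: BeccaSorella2017, §10.4 eq. (10.47)] -/
theorem re_quadForm_nodeRelease_mono {A : Matrix n n ℂ} (hsymm : ∀ i j, A i j = A j i)
    (hreal : ∀ i j, star (A i j) = A i j) (f : n → ℝ) {γ₁ γ₂ : ℝ} (hγ : γ₁ ≤ γ₂) (v : n → ℂ) :
    (star v ⬝ᵥ nodeRelease A f γ₁ *ᵥ v).re ≤ (star v ⬝ᵥ nodeRelease A f γ₂ *ᵥ v).re := by
  rw [re_quadForm_nodeRelease, re_quadForm_nodeRelease]
  have h := fixedNodeCorrection_re_quadForm_nonneg hsymm hreal f v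
  nlinarith

/-! ### Perron–Frobenius in the signed basis -/

omit [Fintype n] [DecidableEq n] in
/-- Transfer of connectivity along an implication that is only required off the diagonal
(self-loops are irrelevant for `ReflTransGen`). [folklore] -/
private theorem reflTransGen_of_imp_off_diag {r p : n → n → Prop}
    (h : ∀ a b, a ≠ b → r a b → p a b) {i j : n} (hij : Relation.ReflTransGen r i j) :
    Relation.ReflTransGen p i j := by
  induction hij with
  | refl => exact Relation.ReflTransGen.refl
  | @tail b c _ hbc ih =>
    by_cases hbc' : b = c
    · subst hbc'
      exact ih
    · exact ih.tail (h b c hbc' hbc)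

omit [DecidableEq n] in
/-- **Perron–Frobenius for ground states in a signed basis.** Let `M` have real symmetric entries,
let `σ : n → ℝ` be a sign vector (`σ i * σ i = 1`) such that `σ i * σ j * Re (M i j) ≤ 0` for
`i ≠ j` (the matrix `diag σ * M * diag σ` has nonpositive off-diagonal entries), and let the graph
`{i ∼ j ⇔ M i j ≠ 0}` be connected. If `E` bounds the quadratic form of `M` from below, every
nonzero solution of `M v = E v` is `c • (σ i * r i)ᵢ` with `r` entrywise strictly positive: the
ground state has exactly the sign structure `σ`. (The tree's `perronFrobenius_groundState_pos`
applied to `diag σ * M * diag σ`.) Lieb–Wu, Physica A 321 (2003) §2;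
Becca–Sorella (2017) §10.4 (text after (10.37)). [cite: LiebWuPhysicaA2003, §2, item 2] -/
theorem perronFrobenius_groundState_pos_signed {M : Matrix n n ℂ} (hsymm : ∀ i j, M i j = M j i)
    (hreal : ∀ i j, star (M i j) = M i j) (σ : n → ℝ) (hσ : ∀ i, σ i * σ i = 1)
    (hoff : ∀ i j, i ≠ j → σ i * σ j * (M i j).re ≤ 0)
    (hconn : ∀ i j, Relation.ReflTransGen (fun a b => M a b ≠ 0) i j) {E : ℝ}
    (hE : ∀ v : n → ℂ, E * (star v ⬝ᵥ v).re ≤ (star v ⬝ᵥ M *ᵥ v).re) {v : n → ℂ}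
    (hv : M *ᵥ v = (E : ℂ) • v) (hv0 : v ≠ 0) :
    ∃ (c : ℂ) (r : n → ℝ), (∀ i, 0 < r i) ∧ v = c • fun i => (((σ i * r i : ℝ)) : ℂ) := by
  have hMim : ∀ i j, (M i j).im = 0 := fun i j => Complex.conj_eq_iff_im.1 (hreal i j)
  have hσ0 : ∀ i, (σ i : ℂ) ≠ 0 := fun i h => by
    have h1 := hσ i
    rw [Complex.ofReal_eq_zero.1 h, zero_mul] at h1
    exact zero_ne_one h1
  have hσC : ∀ i, (σ i : ℂ) * (σ i : ℂ) = 1 := fun i => by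
    rw [← Complex.ofReal_mul, hσ i, Complex.ofReal_one]
  -- the conjugated matrix `B = diag σ * M * diag σ` and the sign flip `w ↦ σ • w`
  set B : Matrix n n ℂ := Matrix.of fun i j => (σ i : ℂ) * M i j * (σ j : ℂ) with hB
  have flip_mulVec : ∀ (w : n → ℂ) (i : n),
      (B *ᵥ w) i = (σ i : ℂ) * (M *ᵥ fun j => (σ j : ℂ) * w j) i := by
    intro w i
    simp only [hB, mulVec, dotProduct, of_apply, Finset.mul_sum]
    refine Finset.sum_congr rfl fun j _ => ?_
    ring
  have flip_quadForm : ∀ w : n → ℂ, star w ⬝ᵥ B *ᵥ w =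
      star (fun j => (σ j : ℂ) * w j) ⬝ᵥ M *ᵥ fun j => (σ j : ℂ) * w j := by
    intro w
    simp only [dotProduct, flip_mulVec, Pi.star_apply, star_mul', Complex.star_def,
      Complex.conj_ofReal]
    refine Finset.sum_congr rfl fun i _ => ?_
    ring
  have flip_norm : ∀ w : n → ℂ,
      (star (fun j => (σ j : ℂ) * w j) ⬝ᵥ fun j => (σ j : ℂ) * w j) = star w ⬝ᵥ w := by
    intro w
    simp only [dotProduct, Pi.star_apply, star_mul', Complex.star_def, Complex.conj_ofReal]
    refine Finset.sum_congr rfl fun i _ => ?_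
    calc (σ i : ℂ) * (starRingEnd ℂ) (w i) * ((σ i : ℂ) * w i)
        = (σ i : ℂ) * (σ i : ℂ) * ((starRingEnd ℂ) (w i) * w i) := by ring
      _ = (starRingEnd ℂ) (w i) * w i := by rw [hσC i, one_mul]
  -- hypotheses of the Perron–Frobenius theorem for `B`
  have hBsymm : ∀ i j, B i j = B j i := fun i j => by
    simp only [hB, of_apply, hsymm i j]
    ring
  have hBreal : ∀ i j, star (B i j) = B i j := fun i j => by
    refine Complex.conj_eq_iff_im.2 ?_
    simp only [hB, of_apply, Complex.im_mul_ofReal, Complex.im_ofReal_mul, hMim i j, mul_zero,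
      zero_mul]
  have hBoff : ∀ i j, i ≠ j → (B i j).re ≤ 0 := fun i j hij => by
    have e : (B i j).re = σ i * σ j * (M i j).re := by
      simp only [hB, of_apply, Complex.re_mul_ofReal, Complex.re_ofReal_mul]
      ring
    rw [e]
    exact hoff i j hij
  have hBconn : ∀ i j, Relation.ReflTransGen (fun a b => B a b ≠ 0) i j := fun i j =>
    reflTransGen_of_imp_off_diag (fun a b _ hab => by
      simp only [hB, of_apply]
      exact mul_ne_zero (mul_ne_zero (hσ0 a) hab) (hσ0 b)) (hconn i j)
  have hBE : ∀ w : n → ℂ, E * (star w ⬝ᵥ w).re ≤ (star w ⬝ᵥ B *ᵥ w).re := fun w => by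
    rw [flip_quadForm, ← flip_norm w]
    exact hE _
  -- the flipped ground state
  set u : n → ℂ := fun j => (σ j : ℂ) * v j with hu_def
  have hvu : ∀ j, v j = (σ j : ℂ) * u j := fun j => by
    simp only [hu_def]
    rw [← mul_assoc, hσC j, one_mul]
  have hu : B *ᵥ u = (E : ℂ) • u := by
    ext i
    rw [flip_mulVec, Pi.smul_apply, smul_eq_mul]
    have : (fun j => (σ j : ℂ) * u j) = v := funext fun j => (hvu j).symm
    rw [this, hv, Pi.smul_apply, smul_eq_mul]
    simp only [hu_def]
    ring
  have hu0 : u ≠ 0 := fun h => hv0 (funext fun j => by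
    rw [hvu j, h, Pi.zero_apply, mul_zero])
  obtain ⟨c, r, hrpos, hc⟩ := perronFrobenius_groundState_pos hBsymm hBreal hBoff hBconn hBE hu hu0
  refine ⟨c, r, hrpos, funext fun j => ?_⟩
  rw [hvu j, hc, Pi.smul_apply, Pi.smul_apply, smul_eq_mul, smul_eq_mul, Complex.ofReal_mul]
  ring

omit [Fintype n] [DecidableEq n] in
/-- `sgn (f i)² = 1` for a nowhere-vanishing real vector. [folklore] -/
private theorem sign_mul_sign_self {f : n → ℝ} (hf : ∀ i, f i ≠ 0) (i : n) :
    Real.sign (f i) * Real.sign (f i) = 1 := by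
  rcases Real.sign_apply_eq_of_ne_zero (f i) (hf i) with h | h <;> rw [h] <;> norm_num

/-- **Sign structure of the fixed-node ground state.** Let `A` have real symmetric entries, let the
guiding vector `f` be nowhere zero, and let the GOOD graph `{b ∼ c ⇔ Re (A b c) · f b · f c < 0}` be
connected. If `E` bounds the quadratic form of `F = FN(A, f)` from below, then every nonzero
solution of `F v = E v` is `c • (sgn (f i) * r i)ᵢ` with `r` entrywise strictly positive: the
fixed-node ground state is unique up to phase and has *exactly the sign structure of the trial
state*. ten Haaf et al., PRB 51 (1995) 13039; Becca–Sorella (2017) §10.4 ("the ground state of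
`ℋ^{fn,γ}` has the same signs of `Ψ_G`"); proof: `perronFrobenius_groundState_pos_signed` with
`σ = sgn f`, using `fixedNodeMatrix_re_apply_mul_mul_nonpos` and the inclusion of the good graph in
the graph of `F`. [cite: BeccaSorella2017, §10.4 after eq. (10.38)] -/
theorem fixedNodeMatrix_groundState_pos_signed {A : Matrix n n ℂ} (hsymm : ∀ i j, A i j = A j i)
    (hreal : ∀ i j, star (A i j) = A i j) {f : n → ℝ} (hf : ∀ i, f i ≠ 0)
    (hconn : ∀ i j, Relation.ReflTransGen (fun b c => (A b c).re * f b * f c < 0) i j) {E : ℝ}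
    (hE : ∀ v : n → ℂ, E * (star v ⬝ᵥ v).re ≤ (star v ⬝ᵥ fixedNodeMatrix A f *ᵥ v).re)
    {v : n → ℂ} (hv : fixedNodeMatrix A f *ᵥ v = (E : ℂ) • v) (hv0 : v ≠ 0) :
    ∃ (c : ℂ) (r : n → ℝ), (∀ i, 0 < r i) ∧
      v = c • fun i => (((Real.sign (f i) * r i : ℝ)) : ℂ) := by
  refine perronFrobenius_groundState_pos_signed (fixedNodeMatrix_symm hsymm f)
    (star_fixedNodeMatrix_apply hreal f) (fun i => Real.sign (f i)) (sign_mul_sign_self hf)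
    (fun i j hij => ?_) (fun i j => ?_) hE hv hv0
  · -- off-diagonal sign in the signed basis
    have h := fixedNodeMatrix_re_apply_mul_mul_nonpos A f hij
    have hp : 0 < Real.sign (f i) * f i * (Real.sign (f j) * f j) :=
      mul_pos (Real.sign_mul_pos_of_ne_zero _ (hf i)) (Real.sign_mul_pos_of_ne_zero _ (hf j))
    refine le_of_not_gt fun hc => ?_
    have h' := mul_pos hc hp
    have e : Real.sign (f i) * Real.sign (f j) * (fixedNodeMatrix A f i j).re *
        (Real.sign (f i) * f i * (Real.sign (f j) * f j)) =
        (fixedNodeMatrix A f i j).re * f i * f j * (Real.sign (f i) * Real.sign (f i)) *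
          (Real.sign (f j) * Real.sign (f j)) := by ring
    rw [e, sign_mul_sign_self hf i, sign_mul_sign_self hf j, mul_one, mul_one] at h'
    exact absurd h (not_le.mpr h')
  · -- the good graph of `A` sits inside the graph of `F`
    exact reflTransGen_of_imp_off_diag
      (fun b c hbc hgood => fixedNodeMatrix_apply_ne_zero_of_good A f hbc hgood) (hconn i j)

end Literature.MathematicalPhysics.QuantumLattice
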